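import Literature.Barriers.AnomalousDissipation.ShearFlowViscositySelectionLimitSteps
import Literature.Barriers.AnomalousDissipation.ShearFlowViscositySelectionTransport
import Literature.Analysis.FluidPDE.LerayResolvedEnergyDistributional
import HarnessLib

/-!
# Bardos–Titi–Wiedemann 2012, Thm. 5 — the limit equation (6) for the weak-* limit of the
third components (proved)

Companion to `Literature/Barriers/AnomalousDissipation/ShearFlowViscositySelectionLimitSteps.lean`,
whose named fact `BardosTitiWiedemann2012_thm5_limitEq` packages the printed sentences
"`u` satisfies (6) [`∂ₜu₃ + v₁(x₂)∂_{x₁}u₃ = 0`, `u₃(0) = v₃`]. Indeed, the equation for `u₃`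
follows from `u₁^ν u₃^ν ⇀* u₁u₃`, thanks to the strong convergence of `u₁^ν` to `u₁`. Next, it
follows from Lemma 4 above that system (6) has a unique solution …" (Bardos–Titi–Wiedemann,
C. R. Math. 350 (2012), proof of Thm. 5). This theorem-only file proves the **first** of these
sentences in the precise form consumed downstream: under the hypotheses of the named fact, the
weak `L²_{t,x}`-limit `W` of the third components satisfies the weak form of the transport
equation of Lemma 4, tested against every smooth `ψ(t, x₁, x₂)` vanishing near `t = T`, read on
`T³` (`BardosTitiWiedemann2012_thm5_limit_weakTransport`):

  `∫₀ᵀ∫_{T³} W (∂ₜψ + v₁(x₂) ∂₁ψ)(t, x₁, x₂) dx dt + ∫_{T³} v₃(x₁,x₂) ψ(0, x₁, x₂) dx = 0`.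

Steps (all proved):

* the vertical test field `Ψ = (0, 0, ψ(t, x₁, x₂))` on `T³` is a smooth space–time test field,
  divergence free because `ψ` does not depend on `x₃` (`isSpaceTimeTest_vertField`,
  `isDivFreeTest_vertField`), and paired with a two-and-a-half-dimensional field
  `u = (a(t,x₂), 0, c(t,x₁,x₂))` it gives `⟪u, ∂ₜΨ⟫ = c ∂ₜψ`, `⟪u, (u·∇)Ψ⟫ = c a ∂₁ψ`,
  `⟪u, ΔΨ⟫ = c ΔΨ₃` (`weakIntegrand_shearField_vertField`);
* the Leray–Hopf weak formulation of `u^ν = (a_j, 0, c_j)` tested with `Ψ` therefore reads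
  `∫∫ c_j ∂ₜψ + ∫∫ c_j a_j ∂₁ψ + ν_j ∫∫ c_j ΔΨ₃ + ∫ v₃ ψ(0) = 0` (`weakForm_shearField_vertField`);
* passage to the limit `j → ∞`: the first pairing converges by the weak convergence
  `c_j ⇀ W`, the third is a convergent sequence times `ν_j → 0`, and the second — the printed
  "`u₁^ν u₃^ν ⇀* u₁u₃` thanks to the strong convergence of `u₁^ν`" — by the weak–strong pairing
  lemma `tendsto_inner_of_norm_le_of_tendsto` (bounded weakly convergent sequence against a
  strongly convergent one) in `L²((0,T) × T³)`.

The identification of `W` with the shear transport (Lemma 4, uniqueness; the reduction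
`T³ → T²`) is the subject of sibling files.

## References

* C. Bardos, E. S. Titi, E. Wiedemann, C. R. Math. Acad. Sci. Paris 350 (2012) 757–760, Thm. 5,
  its proof, system (6) (`BardosTitiWiedemann2012`).
* H. Brezis, *Functional Analysis* (2011), Prop. 3.5 (iv), Prop. 3.13 (iv) (weak–strong
  pairing limits) (`Brezis2011`).
-/

open MeasureTheory Set Filter Topology Function
open scoped ENNReal NNReal InnerProductSpace RealInnerProductSpace

noncomputable section

/-! ## A weak–strong pairing lemma in a real inner product space -/

namespace Literature.Analysis.FunctionSpaces

/-- **Weak–strong pairing** (Brezis 2011, Prop. 3.5 (iv) / 3.13 (iv)): if `‖v j‖ ≤ M`,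
`⟪v j, g⟫ → ⟪w, g⟫` and `g j → g` in norm, then `⟪v j, g j⟫ → ⟪w, g⟫`. [cite: Brezis2011, Prop. 3.5 (iv)] -/
theorem tendsto_inner_of_norm_le_of_tendsto {H : Type*} [NormedAddCommGroup H]
    [InnerProductSpace ℝ H] {v : ℕ → H} {w g : H} {gs : ℕ → H} {M : ℝ} (hM : ∀ j, ‖v j‖ ≤ M)
    (hw : Tendsto (fun j => ⟪v j, g⟫) atTop (𝓝 ⟪w, g⟫)) (hg : Tendsto gs atTop (𝓝 g)) :
    Tendsto (fun j => ⟪v j, gs j⟫) atTop (𝓝 ⟪w, g⟫) := by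
  have h1 : Tendsto (fun j => ⟪v j, gs j - g⟫) atTop (𝓝 0) := by
    have hb : ∀ j, ‖⟪v j, gs j - g⟫‖ ≤ |M| * ‖gs j - g‖ := fun j =>
      (norm_inner_le_norm _ _).trans
        (mul_le_mul_of_nonneg_right ((hM j).trans (le_abs_self M)) (norm_nonneg _))
    have h0 : Tendsto (fun j => |M| * ‖gs j - g‖) atTop (𝓝 0) := by
      have h := (tendsto_iff_norm_sub_tendsto_zero.1 hg).const_mul |M|
      rw [mul_zero] at h
      exact h
    exact squeeze_zero_norm hb h0
  have h2 : ∀ j, ⟪v j, gs j⟫ = ⟪v j, g⟫ + ⟪v j, gs j - g⟫ := fun j => by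
    rw [inner_sub_right]; ring
  simp_rw [h2]
  simpa using hw.add h1

end Literature.Analysis.FunctionSpaces

namespace Literature.Barriers.AnomalousDissipation

/-! ## Functions of `(x₁, x₂)` read on `T³` -/

section Init

/-- `![x 0, x 1] = Fin.init x` on `T³` (the first two coordinates). [folklore] -/
theorem vec2_eq_init (x : UnitAddTorus (Fin 3)) : (![x 0, x 1] : UnitAddTorus (Fin 2)) = Fin.init x := by
  funext i; fin_cases i <;> rfl

/-- Forgetting the last coordinate commutes with the covering maps:
`init (proj z) = proj (z₁, z₂)`. [folklore] -/
theorem init_proj (z : EuclideanSpace ℝ (Fin 3)) :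
    (Fin.init (Literature.Analysis.FunctionSpaces.Torus.proj z) : UnitAddTorus (Fin 2)) =
      Literature.Analysis.FunctionSpaces.Torus.proj
        (WithLp.toLp 2 fun i : Fin 2 => z i.castSucc : EuclideanSpace ℝ (Fin 2)) := by
  funext i; rfl

/-- The coordinate projection `ℝ³ → ℝ²`, `z ↦ (z₁, z₂)`, is smooth. [folklore] -/
theorem contDiff_initE :
    ContDiff ℝ (⊤ : ℕ∞) (fun z : EuclideanSpace ℝ (Fin 3) => (WithLp.toLp 2 fun i : Fin 2 => z i.castSucc : EuclideanSpace ℝ (Fin 2))) :=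
  contDiff_piLp' (p := 2) fun i : Fin 2 => contDiff_piLp_apply (p := 2) (i := i.castSucc)

variable {T : ℝ} {ψ : ℝ → UnitAddTorus (Fin 2) → ℝ}

/-- **A space–time test function of `(t, x₁, x₂)` read on `T³` is a space–time test function**
(its space–time lift is the lift of `ψ` composed with the linear map `(t, z) ↦ (t, z₁, z₂)`). [folklore] -/
theorem isSpaceTimeTest_comp_init (hψ : Literature.Analysis.FunctionSpaces.Torus.IsSpaceTimeTest T ψ) :
    Literature.Analysis.FunctionSpaces.Torus.IsSpaceTimeTest T (fun t (x : UnitAddTorus (Fin 3)) => ψ t (Fin.init x)) := by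
  refine ⟨?_, ?_⟩
  · have h : Literature.Analysis.FunctionSpaces.Torus.stLift (fun t (x : UnitAddTorus (Fin 3)) => ψ t (Fin.init x)) =
        Literature.Analysis.FunctionSpaces.Torus.stLift ψ ∘ fun p : ℝ × EuclideanSpace ℝ (Fin 3) =>
          (p.1, (WithLp.toLp 2 fun i : Fin 2 => p.2 i.castSucc : EuclideanSpace ℝ (Fin 2))) := by
      funext p
      simp only [comp_apply, Literature.Analysis.FunctionSpaces.Torus.stLift, init_proj]
    rw [h]
    exact hψ.1.comp (contDiff_fst.prodMk (contDiff_initE.comp contDiff_snd))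
  · obtain ⟨T', hT', h0⟩ := hψ.2
    exact ⟨T', hT', fun t ht => by funext x; simp [h0 t ht]⟩

/-- Time derivative of the lifted test function: `∂ₜ(ψ ∘ init) = (∂ₜψ) ∘ init`. [folklore] -/
theorem timeDeriv_comp_init (ψ : ℝ → UnitAddTorus (Fin 2) → ℝ) (t : ℝ) (x : UnitAddTorus (Fin 3)) :
    Literature.Analysis.FunctionSpaces.Torus.timeDeriv (fun t (x : UnitAddTorus (Fin 3)) => ψ t (Fin.init x)) t x =
      Literature.Analysis.FunctionSpaces.Torus.timeDeriv ψ t (Fin.init x) := rfl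

/-- First partial derivative of the lift: `∂₁(g ∘ init) = (∂₁g) ∘ init`. [folklore] -/
theorem partialDeriv_zero_comp_init (g : UnitAddTorus (Fin 2) → ℝ) (x : UnitAddTorus (Fin 3)) :
    Literature.Analysis.FunctionSpaces.Torus.partialDeriv 0 (fun x : UnitAddTorus (Fin 3) => g (Fin.init x)) x =
      Literature.Analysis.FunctionSpaces.Torus.partialDeriv 0 g (Fin.init x) := by
  simp only [Literature.Analysis.FunctionSpaces.Torus.partialDeriv,
    Literature.Analysis.FunctionSpaces.Torus.lineDeriv]
  congr 1
  funext s
  congr 1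
  funext i
  fin_cases i <;>
    simp [Fin.init, Literature.Analysis.FunctionSpaces.Torus.proj_apply]

/-- The lift does not depend on `x₃`: `∂₃(g ∘ init) = 0`. [folklore] -/
theorem partialDeriv_two_comp_init (g : UnitAddTorus (Fin 2) → ℝ) (x : UnitAddTorus (Fin 3)) :
    Literature.Analysis.FunctionSpaces.Torus.partialDeriv 2 (fun x : UnitAddTorus (Fin 3) => g (Fin.init x)) x = 0 := by
  simp only [Literature.Analysis.FunctionSpaces.Torus.partialDeriv,
    Literature.Analysis.FunctionSpaces.Torus.lineDeriv]
  have h : (fun s : ℝ => g (Fin.init (x + Literature.Analysis.FunctionSpaces.Torus.proj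
      (s • EuclideanSpace.single (2 : Fin 3) (1 : ℝ))))) = fun _ => g (Fin.init x) := by
    funext s
    congr 1
    funext i
    fin_cases i <;>
      simp [Fin.init, Literature.Analysis.FunctionSpaces.Torus.proj_apply]
  rw [h, deriv_const]

/-- A partial derivative of a constant vanishes. [folklore] -/
theorem partialDeriv_const_zero {d : Type*} [Fintype d] [DecidableEq d] (i : d) (x : UnitAddTorus d) :
    Literature.Analysis.FunctionSpaces.Torus.partialDeriv i (fun _ : UnitAddTorus d => (0 : ℝ)) x = 0 := by
  simp [Literature.Analysis.FunctionSpaces.Torus.partialDeriv,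
    Literature.Analysis.FunctionSpaces.Torus.lineDeriv]

/-- The Laplacian of the zero function vanishes. [folklore] -/
theorem laplacian_const_zero {d : Type*} [Fintype d] [DecidableEq d] (x : UnitAddTorus d) :
    Literature.Analysis.FunctionSpaces.Torus.laplacian (fun _ : UnitAddTorus d => (0 : ℝ)) x = 0 := by
  rw [Literature.Analysis.FunctionSpaces.Torus.laplacian_eq_sum_partialDeriv_partialDeriv
    (Literature.Analysis.FunctionSpaces.Torus.isSmooth_const (0 : ℝ))]
  refine Finset.sum_eq_zero fun i _ => ?_
  have h : Literature.Analysis.FunctionSpaces.Torus.partialDeriv i (fun _ : UnitAddTorus d => (0 : ℝ)) =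
      fun _ => 0 := funext (partialDeriv_const_zero i)
  rw [h]
  exact partialDeriv_const_zero i x

/-- Slices of a space–time test function are differentiable in time. [folklore] -/
theorem differentiableAt_slice {d : Type*} [Fintype d] {φ : ℝ → UnitAddTorus d → ℝ}
    (hφ : Literature.Analysis.FunctionSpaces.Torus.IsSpaceTimeTest T φ) (t : ℝ) (x : UnitAddTorus d) :
    DifferentiableAt ℝ (fun τ => φ τ x) t := by
  obtain ⟨z, hz⟩ := Literature.Analysis.FunctionSpaces.Torus.proj_surjective x
  have h : (fun τ => φ τ x) = Literature.Analysis.FunctionSpaces.Torus.stLift φ ∘ fun τ => (τ, z) := by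
    funext τ; simp [Literature.Analysis.FunctionSpaces.Torus.stLift, hz]
  rw [h]
  exact ((hφ.1.differentiable (by simp)).comp
    (differentiable_id.prodMk (differentiable_const z))).differentiableAt

end Init

/-! ## The vertical test field `(0, 0, φ)` -/

section VertField

/-- Components of the vertical field. [folklore] -/
theorem vertField_apply (φ : ℝ → UnitAddTorus (Fin 3) → ℝ) (t : ℝ) (x : UnitAddTorus (Fin 3)) :
    Literature.Analysis.FluidPDE.Torus.vecField ![(0 : ℝ → UnitAddTorus (Fin 3) → ℝ), 0, φ] t x 0 = 0 ∧
      Literature.Analysis.FluidPDE.Torus.vecField ![(0 : ℝ → UnitAddTorus (Fin 3) → ℝ), 0, φ] t x 1 = 0 ∧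
      Literature.Analysis.FluidPDE.Torus.vecField ![(0 : ℝ → UnitAddTorus (Fin 3) → ℝ), 0, φ] t x 2 = φ t x := by
  simp [Literature.Analysis.FluidPDE.Torus.vecField]

variable {T : ℝ} {φ : ℝ → UnitAddTorus (Fin 3) → ℝ}

/-- **The vertical field `(0, 0, φ)` is a space–time test field** when `φ` is. [folklore] -/
theorem isSpaceTimeTest_vertField (hφ : Literature.Analysis.FunctionSpaces.Torus.IsSpaceTimeTest T φ) :
    Literature.Analysis.FunctionSpaces.Torus.IsSpaceTimeTest T
      (Literature.Analysis.FluidPDE.Torus.vecField ![(0 : ℝ → UnitAddTorus (Fin 3) → ℝ), 0, φ]) := by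
  refine ⟨?_, ?_⟩
  · rw [Literature.Analysis.FluidPDE.Torus.stLift_vecField]
    refine contDiff_piLp' (p := 2) fun j => ?_
    fin_cases j
    · simpa [Literature.Analysis.FunctionSpaces.Torus.stLift] using contDiff_const (c := (0 : ℝ))
    · simpa [Literature.Analysis.FunctionSpaces.Torus.stLift] using contDiff_const (c := (0 : ℝ))
    · simpa using hφ.1
  · obtain ⟨T', hT', h0⟩ := hφ.2
    refine ⟨T', hT', fun t ht => ?_⟩
    funext x
    ext j
    fin_cases j <;> simp [Literature.Analysis.FluidPDE.Torus.vecField, h0 t ht]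

/-- **The vertical field `(0, 0, φ)` is divergence free when `∂₃φ = 0`.** [folklore] -/
theorem isDivFreeTest_vertField
    (h2 : ∀ t x, Literature.Analysis.FunctionSpaces.Torus.partialDeriv 2 (φ t) x = 0) :
    Literature.Analysis.FunctionSpaces.Torus.IsDivFreeTest
      (Literature.Analysis.FluidPDE.Torus.vecField ![(0 : ℝ → UnitAddTorus (Fin 3) → ℝ), 0, φ]) := by
  intro t x
  rw [Literature.Analysis.FunctionSpaces.Torus.divergence, Fin.sum_univ_three]
  have h0 : (fun y : UnitAddTorus (Fin 3) => Literature.Analysis.FluidPDE.Torus.vecField ![(0 : ℝ → UnitAddTorus (Fin 3) → ℝ), 0, φ] t y 0) =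
      fun _ => 0 := funext fun y => (vertField_apply φ t y).1
  have h1 : (fun y : UnitAddTorus (Fin 3) => Literature.Analysis.FluidPDE.Torus.vecField ![(0 : ℝ → UnitAddTorus (Fin 3) → ℝ), 0, φ] t y 1) =
      fun _ => 0 := funext fun y => (vertField_apply φ t y).2.1
  have h2' : (fun y : UnitAddTorus (Fin 3) => Literature.Analysis.FluidPDE.Torus.vecField ![(0 : ℝ → UnitAddTorus (Fin 3) → ℝ), 0, φ] t y 2) =
      φ t := funext fun y => (vertField_apply φ t y).2.2
  rw [h0, h1, h2', partialDeriv_const_zero, partialDeriv_const_zero, h2 t x]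
  ring

/-- **The Navier–Stokes weak integrand of a two-and-a-half-dimensional field against the
vertical test field**: for `u = (a(t,x₂), 0, c(t,x₁,x₂))` and `Ψ = (0, 0, φ)` with `∂₃φ = 0`,
`⟪u, ∂ₜΨ⟫ + ⟪u, (u·∇)Ψ⟫ + ν⟪u, ΔΨ⟫ = c ∂ₜφ + c a ∂₁φ + ν c Δφ` (Bardos–Titi–Wiedemann 2012,
proof of Thm. 5: the third equation of the two-and-a-half-dimensional system, tested). [cite: BardosTitiWiedemann2012, Thm. 5, proof] -/
theorem weakIntegrand_shearField_vertField (hφ : Literature.Analysis.FunctionSpaces.Torus.IsSpaceTimeTest T φ)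
    (h2 : ∀ t x, Literature.Analysis.FunctionSpaces.Torus.partialDeriv 2 (φ t) x = 0)
    (a : ℝ → UnitAddCircle → ℝ) (c : ℝ → UnitAddTorus (Fin 2) → ℝ) (ν t : ℝ) (x : UnitAddTorus (Fin 3)) :
    ⟪shearField a c t x, Literature.Analysis.FunctionSpaces.Torus.timeDeriv
        (Literature.Analysis.FluidPDE.Torus.vecField ![(0 : ℝ → UnitAddTorus (Fin 3) → ℝ), 0, φ]) t x⟫ +
      ⟪shearField a c t x, Literature.Analysis.FunctionSpaces.Torus.convect (shearField a c t)
        (Literature.Analysis.FluidPDE.Torus.vecField ![(0 : ℝ → UnitAddTorus (Fin 3) → ℝ), 0, φ] t) x⟫ +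
      ν * ⟪shearField a c t x, Literature.Analysis.FunctionSpaces.Torus.laplacian
        (Literature.Analysis.FluidPDE.Torus.vecField ![(0 : ℝ → UnitAddTorus (Fin 3) → ℝ), 0, φ] t) x⟫ =
    c t ![x 0, x 1] * Literature.Analysis.FunctionSpaces.Torus.timeDeriv φ t x +
      c t ![x 0, x 1] * (a t (x 1) * Literature.Analysis.FunctionSpaces.Torus.partialDeriv 0 (φ t) x) +
      ν * (c t ![x 0, x 1] * Literature.Analysis.FunctionSpaces.Torus.laplacian (φ t) x) := by
  -- regularity of the components
  have hsm : ∀ j, Literature.Analysis.FunctionSpaces.Torus.IsSmooth ((![(0 : ℝ → UnitAddTorus (Fin 3) → ℝ), 0, φ] j) t) := by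
    intro j
    fin_cases j
    · exact Literature.Analysis.FunctionSpaces.Torus.isSmooth_const (0 : ℝ)
    · exact Literature.Analysis.FunctionSpaces.Torus.isSmooth_const (0 : ℝ)
    · exact hφ.isSmooth_slice t
  have hcd : ∀ j, Literature.Analysis.FunctionSpaces.Torus.IsContDiff 1 ((![(0 : ℝ → UnitAddTorus (Fin 3) → ℝ), 0, φ] j) t) :=
    fun j => (hsm j).isContDiff (by simp)
  have hdt : ∀ j, DifferentiableAt ℝ (fun τ => (![(0 : ℝ → UnitAddTorus (Fin 3) → ℝ), 0, φ] j) τ x) t := by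
    intro j
    fin_cases j
    · exact differentiableAt_const _
    · exact differentiableAt_const _
    · exact differentiableAt_slice hφ t x
  rw [Literature.Analysis.FluidPDE.Torus.inner_timeDeriv_vecField hdt,
    Literature.Analysis.FluidPDE.Torus.inner_convect_vecField hcd,
    Literature.Analysis.FluidPDE.Torus.inner_laplacian_vecField hsm]
  have ht0 : Literature.Analysis.FunctionSpaces.Torus.timeDeriv (0 : ℝ → UnitAddTorus (Fin 3) → ℝ) t x = 0 := by
    simp [Literature.Analysis.FunctionSpaces.Torus.timeDeriv]
  have hp0 : ∀ i : Fin 3, Literature.Analysis.FunctionSpaces.Torus.partialDeriv i ((0 : ℝ → UnitAddTorus (Fin 3) → ℝ) t) x = 0 :=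
    fun i => partialDeriv_const_zero i x
  have hl0 : Literature.Analysis.FunctionSpaces.Torus.laplacian ((0 : ℝ → UnitAddTorus (Fin 3) → ℝ) t) x = 0 :=
    laplacian_const_zero x
  simp only [Fin.sum_univ_three, Matrix.cons_val_zero, Matrix.cons_val_one, Matrix.cons_val_two,
    Matrix.head_cons, Matrix.tail_cons, ht0, hp0, hl0, h2 t x, shearField_apply]
  ring

/-- The datum pairing: `⟪v₀, Ψ(0)⟫ = v₃(x₁,x₂) φ(0, x)`. [folklore] -/
theorem inner_shearData_vertField (v₁ : UnitAddCircle → ℝ) (v₃ : UnitAddTorus (Fin 2) → ℝ) (φ : ℝ → UnitAddTorus (Fin 3) → ℝ) (x : UnitAddTorus (Fin 3)) :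
    ⟪shearData v₁ v₃ x, Literature.Analysis.FluidPDE.Torus.vecField ![(0 : ℝ → UnitAddTorus (Fin 3) → ℝ), 0, φ] 0 x⟫ =
      v₃ ![x 0, x 1] * φ 0 x := by
  simp [shearData, Literature.Analysis.FluidPDE.Torus.vecField, PiLp.inner_apply, Fin.sum_univ_three,
    mul_comm]

end VertField

/-! ## The Leray–Hopf weak formulation tested with the vertical field -/

section WeakForm

variable {T ν : ℝ} {v₁ : UnitAddCircle → ℝ} {v₃ : UnitAddTorus (Fin 2) → ℝ} {a : ℝ → UnitAddCircle → ℝ}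
  {c : ℝ → UnitAddTorus (Fin 2) → ℝ}

/-- **The weak formulation of a two-and-a-half-dimensional Leray–Hopf solution against
`(0, 0, ψ(t,x₁,x₂))`** (Bardos–Titi–Wiedemann 2012, proof of Thm. 5, the equation for `u₃^ν`
in weak form): for `u = (a(t,x₂), 0, c(t,x₁,x₂))` Leray–Hopf with shear datum and a smooth
`ψ` on `T² × [0,T)`,
`∫₀ᵀ∫_{T³} (c ∂ₜψ + c a ∂₁ψ + ν c Δ(ψ∘init)) dx dt + ∫_{T³} v₃ ψ(0) dx = 0`. [cite: BardosTitiWiedemann2012, Thm. 5, proof] -/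
theorem weakForm_shearField_vertField
    (hU : Literature.Analysis.FluidPDE.Torus.IsLerayHopfOn T ν 0 (shearData v₁ v₃) (shearField a c))
    {ψ : ℝ → UnitAddTorus (Fin 2) → ℝ} (hψ : Literature.Analysis.FunctionSpaces.Torus.IsSpaceTimeTest T ψ) :
    (∫ t in Ioo 0 T, ∫ x : UnitAddTorus (Fin 3),
        (c t (Fin.init x) * Literature.Analysis.FunctionSpaces.Torus.timeDeriv ψ t (Fin.init x) +
          c t (Fin.init x) * (a t (x 1) *
            Literature.Analysis.FunctionSpaces.Torus.partialDeriv 0 (ψ t) (Fin.init x)) +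
          ν * (c t (Fin.init x) *
            Literature.Analysis.FunctionSpaces.Torus.laplacian (fun y : UnitAddTorus (Fin 3) => ψ t (Fin.init y)) x))) +
      ∫ x : UnitAddTorus (Fin 3), v₃ (Fin.init x) * ψ 0 (Fin.init x) = 0 := by
  have hφ := isSpaceTimeTest_comp_init hψ
  have h2 : ∀ t x, Literature.Analysis.FunctionSpaces.Torus.partialDeriv 2
      ((fun t (x : UnitAddTorus (Fin 3)) => ψ t (Fin.init x)) t) x = 0 := fun t x => partialDeriv_two_comp_init (ψ t) x
  have hw := hU.isWeakNSSolutionWithDataOn.2.2.2 _ (isSpaceTimeTest_vertField hφ)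
    (isDivFreeTest_vertField h2)
  simp_rw [weakIntegrand_shearField_vertField hφ h2, inner_shearData_vertField] at hw
  have hp : ∀ t (x : UnitAddTorus (Fin 3)), Literature.Analysis.FunctionSpaces.Torus.partialDeriv 0
      ((fun t (x : UnitAddTorus (Fin 3)) => ψ t (Fin.init x)) t) x =
      Literature.Analysis.FunctionSpaces.Torus.partialDeriv 0 (ψ t) (Fin.init x) :=
    fun t x => partialDeriv_zero_comp_init (ψ t) x
  have ht : ∀ t (x : UnitAddTorus (Fin 3)), Literature.Analysis.FunctionSpaces.Torus.timeDeriv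
      (fun t (x : UnitAddTorus (Fin 3)) => ψ t (Fin.init x)) t x =
      Literature.Analysis.FunctionSpaces.Torus.timeDeriv ψ t (Fin.init x) := fun t x => rfl
  simp_rw [hp, ht, vec2_eq_init] at hw
  exact hw

end WeakForm

/-! ## Square-integrable space–time functions: continuous multipliers, the limit field -/

section L2Glue

variable {T : ℝ} {d : Type*} [Fintype d]

/-- **A jointly continuous space–time function is a bounded square-integrable space–time
function on `(0,T) × T^d`**: measurable lift, a uniform bound on `[0,T] × T^d`, finite
`∫₀ᵀ∫ |b|²`, and membership in `L²((vol|_(0,T)) ⊗ vol)`. [folklore] -/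
theorem spaceTime_of_continuous_uncurry {b : ℝ → UnitAddTorus d → ℝ} (hb : Continuous (uncurry b)) (T : ℝ) :
    AEStronglyMeasurable (Literature.Analysis.FunctionSpaces.Torus.stLift b)
        (volume.restrict (Ioo 0 T ×ˢ univ)) ∧
      (∃ K : ℝ, ∀ t ∈ Icc 0 T, ∀ x, ‖b t x‖ ≤ K) ∧
      ∫⁻ t in Ioo 0 T, ∫⁻ x, ‖b t x‖ₑ ^ 2 < ∞ ∧
      MemLp (uncurry b) 2 (((volume : Measure ℝ).restrict (Ioo 0 T)).prod (volume : Measure (UnitAddTorus d))) := by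
  have hst : Continuous (Literature.Analysis.FunctionSpaces.Torus.stLift b) :=
    hb.comp (continuous_id.prodMap Literature.Analysis.FunctionSpaces.Torus.continuous_proj)
  have hm : AEStronglyMeasurable (Literature.Analysis.FunctionSpaces.Torus.stLift b)
      (volume.restrict (Ioo 0 T ×ˢ univ)) := hst.aestronglyMeasurable
  obtain ⟨K, hK⟩ := Literature.Analysis.FluidPDE.Torus.exists_bound_of_continuous_uncurry hb 0 T
  have hfin : ∫⁻ t in Ioo 0 T, ∫⁻ x, ‖b t x‖ₑ ^ 2 < ∞ := by
    have hslice : ∀ t ∈ Ioo (0 : ℝ) T, ∫⁻ x, ‖b t x‖ₑ ^ 2 ≤ ENNReal.ofReal (K ^ 2) := by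
      intro t ht
      calc ∫⁻ x, ‖b t x‖ₑ ^ 2 ≤ ∫⁻ _ : UnitAddTorus d, ENNReal.ofReal (K ^ 2) := by
            refine lintegral_mono fun x => ?_
            rw [← ofReal_norm, ← ENNReal.ofReal_pow (norm_nonneg _)]
            exact ENNReal.ofReal_le_ofReal (pow_le_pow_left₀ (norm_nonneg _)
              (hK t (Ioo_subset_Icc_self ht) x) 2)
        _ = ENNReal.ofReal (K ^ 2) := by rw [lintegral_const, measure_univ, mul_one]
    calc ∫⁻ t in Ioo 0 T, ∫⁻ x, ‖b t x‖ₑ ^ 2 ≤ ∫⁻ _ in Ioo (0 : ℝ) T, ENNReal.ofReal (K ^ 2) :=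
          setLIntegral_mono measurable_const hslice
      _ < ∞ := by
          rw [lintegral_const, Measure.restrict_apply_univ]
          exact ENNReal.mul_lt_top ENNReal.ofReal_lt_top measure_Ioo_lt_top
  exact ⟨hm, ⟨K, hK⟩, hfin, (Literature.Analysis.FunctionSpaces.Torus.memLp_two_uncurry
    (Literature.Analysis.FunctionSpaces.Torus.aestronglyMeasurable_uncurry_of_stLift_prod hm) hfin).1⟩

/-- From `L²((vol|_(0,T)) ⊗ vol)` to finite `∫₀ᵀ∫ |G|²` (Tonelli). [folklore] -/
theorem lintegral_lt_top_of_memLp_uncurry {G : ℝ → UnitAddTorus d → ℝ}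
    (hG : MemLp (uncurry G) 2 (((volume : Measure ℝ).restrict (Ioo 0 T)).prod (volume : Measure (UnitAddTorus d)))) :
    ∫⁻ t in Ioo 0 T, ∫⁻ x, ‖G t x‖ₑ ^ 2 < ∞ := by
  have h : ∫⁻ t in Ioo 0 T, ∫⁻ x, ‖G t x‖ₑ ^ 2 =
      eLpNorm (uncurry G) 2 (((volume : Measure ℝ).restrict (Ioo 0 T)).prod (volume : Measure (UnitAddTorus d))) ^ 2 := by
    rw [Literature.Analysis.FunctionSpaces.eLpNorm_two_pow_two_eq_lintegral,
      lintegral_prod _ (hG.1.enorm.pow_const 2)]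
    rfl
  rw [h]
  exact ENNReal.pow_lt_top hG.eLpNorm_lt_top

/-- **A product with a bounded continuous multiplier stays in `L²`**, with the norm bound
`‖f b‖₂ ≤ K ‖f‖₂` for a bound `K` of `b` on `[0,T] × T^d`. [folklore] -/
theorem memLp_mul_of_bound {f b : ℝ → UnitAddTorus d → ℝ}
    (hf : MemLp (uncurry f) 2 (((volume : Measure ℝ).restrict (Ioo 0 T)).prod (volume : Measure (UnitAddTorus d))))
    (hbm : AEStronglyMeasurable (uncurry b) (((volume : Measure ℝ).restrict (Ioo 0 T)).prod (volume : Measure (UnitAddTorus d))))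
    {K : ℝ} (hK : ∀ t ∈ Icc 0 T, ∀ x, ‖b t x‖ ≤ K) :
    MemLp (uncurry fun t x => f t x * b t x) 2
        (((volume : Measure ℝ).restrict (Ioo 0 T)).prod (volume : Measure (UnitAddTorus d))) ∧
      eLpNorm (uncurry fun t x => f t x * b t x) 2
          (((volume : Measure ℝ).restrict (Ioo 0 T)).prod (volume : Measure (UnitAddTorus d))) ≤
        ENNReal.ofReal K * eLpNorm (uncurry f) 2
          (((volume : Measure ℝ).restrict (Ioo 0 T)).prod (volume : Measure (UnitAddTorus d))) := by
  have hae : ∀ᵐ z ∂(((volume : Measure ℝ).restrict (Ioo 0 T)).prod (volume : Measure (UnitAddTorus d))),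
      z.1 ∈ Ioo 0 T :=
    (Measure.quasiMeasurePreserving_fst (μ := (volume : Measure ℝ).restrict (Ioo 0 T))
      (ν := (volume : Measure (UnitAddTorus d)))).ae (ae_restrict_mem measurableSet_Ioo)
  have hle : ∀ᵐ z ∂(((volume : Measure ℝ).restrict (Ioo 0 T)).prod (volume : Measure (UnitAddTorus d))),
      ‖uncurry (fun t x => f t x * b t x) z‖ ≤ K * ‖uncurry f z‖ := by
    filter_upwards [hae] with z hz
    simp only [uncurry, norm_mul]
    rw [mul_comm K]
    exact mul_le_mul_of_nonneg_left (hK z.1 (Ioo_subset_Icc_self hz) z.2) (norm_nonneg _)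
  exact ⟨MemLp.of_le_mul hf (hf.1.mul hbm) hle, eLpNorm_le_mul_eLpNorm_of_ae_le_mul hle 2⟩

/-- **The limit field is a square-integrable space–time function**: measurable lift and an
`L^∞_t L²_x` bound give `W ∈ L²((vol|_(0,T)) ⊗ vol)`. [folklore] -/
theorem memLp_uncurry_of_bound {W : ℝ → UnitAddTorus d → ℝ}
    (hWm : AEStronglyMeasurable (Literature.Analysis.FunctionSpaces.Torus.stLift W)
      (volume.restrict (Ioo 0 T ×ˢ univ)))
    (hWb : ∃ C : ℝ≥0, ∀ᵐ t ∂(volume.restrict (Ioo 0 T)), ∫⁻ x, ‖W t x‖ₑ ^ 2 ≤ C) :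
    ∫⁻ t in Ioo 0 T, ∫⁻ x, ‖W t x‖ₑ ^ 2 < ∞ ∧
      MemLp (uncurry W) 2 (((volume : Measure ℝ).restrict (Ioo 0 T)).prod (volume : Measure (UnitAddTorus d))) := by
  obtain ⟨C, hC⟩ := hWb
  have hfin : ∫⁻ t in Ioo 0 T, ∫⁻ x, ‖W t x‖ₑ ^ 2 < ∞ := by
    refine (lintegral_mono_ae hC).trans_lt ?_
    rw [lintegral_const, Measure.restrict_apply_univ]
    exact ENNReal.mul_lt_top ENNReal.coe_lt_top measure_Ioo_lt_top
  exact ⟨hfin, (Literature.Analysis.FunctionSpaces.Torus.memLp_two_uncurry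
    (Literature.Analysis.FunctionSpaces.Torus.aestronglyMeasurable_uncurry_of_stLift_prod hWm) hfin).1⟩

/-- **Components of two-and-a-half-dimensional Leray–Hopf solutions as square-integrable
space–time functions on `T³`**: for `u = (a(t,x₂), 0, c(t,x₁,x₂))` Leray–Hopf with datum `u₀`,
`(t,x) ↦ a(t,x₂)` and `(t,x) ↦ c(t,x₁,x₂)` lie in `L²((vol|_(0,T)) ⊗ vol)`, the latter with
slices bounded by the initial energy. [folklore] -/
theorem shearField_components_memLp {ν : ℝ} (hν : 0 ≤ ν) {u₀ : UnitAddTorus (Fin 3) → EuclideanSpace ℝ (Fin 3)} (hu₀ : MemLp u₀ 2 volume)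
    {a : ℝ → UnitAddCircle → ℝ} {c : ℝ → UnitAddTorus (Fin 2) → ℝ}
    (hu : Literature.Analysis.FluidPDE.Torus.IsLerayHopfOn T ν 0 u₀ (shearField a c)) :
    MemLp (uncurry fun t (x : UnitAddTorus (Fin 3)) => a t (x 1)) 2
        (((volume : Measure ℝ).restrict (Ioo 0 T)).prod (volume : Measure (UnitAddTorus (Fin 3)))) ∧
      MemLp (uncurry fun t (x : UnitAddTorus (Fin 3)) => c t (Fin.init x)) 2
        (((volume : Measure ℝ).restrict (Ioo 0 T)).prod (volume : Measure (UnitAddTorus (Fin 3)))) ∧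
      (∀ t ∈ Icc 0 T, ∫⁻ x : UnitAddTorus (Fin 3), ‖c t (Fin.init x)‖ₑ ^ 2 ≤ ∫⁻ x, ‖u₀ x‖ₑ ^ 2) ∧
      AEStronglyMeasurable (Literature.Analysis.FunctionSpaces.Torus.stLift fun t (x : UnitAddTorus (Fin 3)) => c t (Fin.init x))
        (volume.restrict (Ioo 0 T ×ˢ univ)) := by
  have hA := lerayHopf_component_memLp hν hu₀ hu 0
  have hC := lerayHopf_component_memLp hν hu₀ hu 2
  have hA_eq : ∀ t (x : UnitAddTorus (Fin 3)), shearField a c t x 0 = a t (x 1) := fun t x => (shearField_apply _ _ t x).1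
  have hC_eq : ∀ t (x : UnitAddTorus (Fin 3)), shearField a c t x 2 = c t (Fin.init x) := fun t x => by
    rw [(shearField_apply _ _ t x).2.2, vec2_eq_init]
  obtain ⟨-, -, -, hA4⟩ := hA
  obtain ⟨hC1, hC2, -, hC4⟩ := hC
  simp_rw [hA_eq] at hA4
  simp_rw [hC_eq] at hC1 hC2 hC4
  exact ⟨hA4, hC4, hC2, hC1⟩

end L2Glue

/-! ## Passage to the limit: the weak transport equation for the limit of the third components -/

section Limit

/-- **Bardos–Titi–Wiedemann 2012, proof of Thm. 5: the weak-* limit of the third components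
solves the linear transport equation (6) weakly** — the printed "`u` satisfies (6) … Indeed, the
equation for `u₃` follows from `u₁^ν u₃^ν ⇀* u₁u₃`, thanks to the strong convergence of `u₁^ν` to
`u₁`", under exactly the hypotheses of `BardosTitiWiedemann2012_thm5_limitEq`: for every smooth
`ψ(t, x₁, x₂)` vanishing near `t = T`,
`∫₀ᵀ∫_{T³} W (∂ₜψ + v₁(x₂)∂₁ψ) dx dt + ∫_{T³} v₃(x₁,x₂) ψ(0,x₁,x₂) dx = 0`.
Proof: `weakForm_shearField_vertField` for each `j`, then `j → ∞` termwise — weak convergence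
against `∂ₜψ`, the weak–strong pairing `tendsto_inner_of_norm_le_of_tendsto` for `c_j a_j ∂₁ψ`
(the `c_j` are bounded in `L²_{t,x}` by the energy inequality, `a_j ∂₁ψ → v₁ ∂₁ψ` strongly), and
`ν_j` times the convergent pairings with `Δ(ψ∘init)`. [cite: BardosTitiWiedemann2012, Thm. 5, proof] -/
theorem BardosTitiWiedemann2012_thm5_limit_weakTransport
    (v₁ : UnitAddCircle → ℝ) (hv₁ : MemLp v₁ 2 volume) (v₃ : UnitAddTorus (Fin 2) → ℝ) (hv₃ : MemLp v₃ 2 volume)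
    (T : ℝ) (ν : ℕ → ℝ) (hν : ∀ j, 0 < ν j) (hν₀ : Tendsto ν atTop (𝓝 0))
    (a : ℕ → ℝ → UnitAddCircle → ℝ) (c : ℕ → ℝ → UnitAddTorus (Fin 2) → ℝ)
    (hU : ∀ j, Literature.Analysis.FluidPDE.Torus.IsLerayHopfOn T (ν j) 0 (shearData v₁ v₃)
      (shearField (a j) (c j)))
    (W : ℝ → UnitAddTorus (Fin 3) → ℝ)
    (hWm : AEStronglyMeasurable (Literature.Analysis.FunctionSpaces.Torus.stLift W)
      (volume.restrict (Ioo 0 T ×ˢ univ)))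
    (hWb : ∃ C : ℝ≥0, ∀ᵐ t ∂(volume.restrict (Ioo 0 T)), ∫⁻ x, ‖W t x‖ₑ ^ 2 ≤ C)
    (hheat : Tendsto (fun j => ∫⁻ t in Ioo 0 T, ∫⁻ x : UnitAddTorus (Fin 3), ‖a j t (x 1) - v₁ (x 1)‖ₑ ^ 2)
      atTop (𝓝 0))
    (hweak : ∀ G : ℝ → UnitAddTorus (Fin 3) → ℝ,
      AEStronglyMeasurable (Literature.Analysis.FunctionSpaces.Torus.stLift G)
        (volume.restrict (Ioo 0 T ×ˢ univ)) →
      ∫⁻ t in Ioo 0 T, ∫⁻ x, ‖G t x‖ₑ ^ 2 < ∞ →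
      Tendsto (fun j => ∫ t in Ioo 0 T, ∫ x, c j t ![x 0, x 1] * G t x) atTop
        (𝓝 (∫ t in Ioo 0 T, ∫ x, W t x * G t x)))
    {ψ : ℝ → UnitAddTorus (Fin 2) → ℝ} (hψ : Literature.Analysis.FunctionSpaces.Torus.IsSpaceTimeTest T ψ) :
    (∫ t in Ioo 0 T, ∫ x : UnitAddTorus (Fin 3), W t x *
        (Literature.Analysis.FunctionSpaces.Torus.timeDeriv ψ t (Fin.init x) +
          v₁ (x 1) * Literature.Analysis.FunctionSpaces.Torus.partialDeriv 0 (ψ t) (Fin.init x))) +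
      ∫ x : UnitAddTorus (Fin 3), v₃ (Fin.init x) * ψ 0 (Fin.init x) = 0 := by
  -- the space–time measure and the basic memberships
  have hmem : MemLp (shearData v₁ v₃) 2 volume := memLp_shearData hv₁ hv₃
  have hE₀ : ∫⁻ x, ‖shearData v₁ v₃ x‖ₑ ^ 2 < ∞ := by
    rw [lintegral_enorm_sq_eq_ofReal_kineticEnergy hmem]; exact ENNReal.ofReal_lt_top
  obtain ⟨hWfin, hWL⟩ := memLp_uncurry_of_bound hWm hWb
  have hcomp := fun j => shearField_components_memLp (hν j).le hmem (hU j)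
  have hV : MemLp (uncurry fun (_ : ℝ) (x : UnitAddTorus (Fin 3)) => v₁ (x 1)) 2
      (((volume : Measure ℝ).restrict (Ioo 0 T)).prod (volume : Measure (UnitAddTorus (Fin 3)))) :=
    memLp_uncurry_const_eval_one hv₁
  -- `hweak` in `L²` form, with `Fin.init`
  have hweak' : ∀ G : ℝ → UnitAddTorus (Fin 3) → ℝ,
      MemLp (uncurry G) 2 (((volume : Measure ℝ).restrict (Ioo 0 T)).prod (volume : Measure (UnitAddTorus (Fin 3)))) →
      Tendsto (fun j => ∫ t in Ioo 0 T, ∫ x : UnitAddTorus (Fin 3), c j t (Fin.init x) * G t x) atTop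
        (𝓝 (∫ t in Ioo 0 T, ∫ x, W t x * G t x)) := by
    intro G hG
    have h := hweak G (Literature.Analysis.FunctionSpaces.Torus.aestronglyMeasurable_stLift_of_uncurry hG.1)
      (lintegral_lt_top_of_memLp_uncurry hG)
    simp_rw [vec2_eq_init] at h
    exact h
  -- the three multipliers
  have hφ := isSpaceTimeTest_comp_init hψ
  have hb₁ := spaceTime_of_continuous_uncurry
    (b := fun t (x : UnitAddTorus (Fin 3)) => Literature.Analysis.FunctionSpaces.Torus.timeDeriv ψ t (Fin.init x))
    hφ.continuous_uncurry_timeDeriv T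
  have hinit : Continuous (Fin.init : UnitAddTorus (Fin 3) → UnitAddTorus (Fin 2)) := continuous_pi fun i => continuous_apply _
  have hb₂ := spaceTime_of_continuous_uncurry
    (b := fun t (x : UnitAddTorus (Fin 3)) => Literature.Analysis.FunctionSpaces.Torus.partialDeriv 0 (ψ t) (Fin.init x))
    ((hψ.continuous_uncurry_partialDeriv 0).comp (continuous_fst.prodMk (hinit.comp continuous_snd))) T
  have hb₃ := spaceTime_of_continuous_uncurry
    (b := fun t (x : UnitAddTorus (Fin 3)) => Literature.Analysis.FunctionSpaces.Torus.laplacian (fun y : UnitAddTorus (Fin 3) => ψ t (Fin.init y)) x)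
    hφ.continuous_uncurry_laplacian T
  obtain ⟨-, ⟨K, hK⟩, -, hb₂L⟩ := hb₂
  have hb₂m := hb₂L.1
  -- the products `a_j ∂₁ψ`, `v₁ ∂₁ψ`
  have hAb := fun j => memLp_mul_of_bound (hcomp j).1 hb₂m hK
  have hVb := memLp_mul_of_bound hV hb₂m hK
  -- the four terms of the weak formulation for each `j`
  set I₁ : ℕ → ℝ := fun j => ∫ t in Ioo 0 T, ∫ x : UnitAddTorus (Fin 3),
    c j t (Fin.init x) * Literature.Analysis.FunctionSpaces.Torus.timeDeriv ψ t (Fin.init x) with hI₁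
  set I₂ : ℕ → ℝ := fun j => ∫ t in Ioo 0 T, ∫ x : UnitAddTorus (Fin 3),
    c j t (Fin.init x) * (a j t (x 1) *
      Literature.Analysis.FunctionSpaces.Torus.partialDeriv 0 (ψ t) (Fin.init x)) with hI₂
  set I₃ : ℕ → ℝ := fun j => ∫ t in Ioo 0 T, ∫ x : UnitAddTorus (Fin 3),
    c j t (Fin.init x) * Literature.Analysis.FunctionSpaces.Torus.laplacian
      (fun y : UnitAddTorus (Fin 3) => ψ t (Fin.init y)) x with hI₃
  set D : ℝ := ∫ x : UnitAddTorus (Fin 3), v₃ (Fin.init x) * ψ 0 (Fin.init x) with hD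
  have hsplit : ∀ j, I₁ j + I₂ j + ν j * I₃ j + D = 0 := by
    intro j
    have hw := weakForm_shearField_vertField (hU j) hψ
    have hi₁ : Integrable (uncurry fun t (x : UnitAddTorus (Fin 3)) =>
        c j t (Fin.init x) * Literature.Analysis.FunctionSpaces.Torus.timeDeriv ψ t (Fin.init x))
        (((volume : Measure ℝ).restrict (Ioo 0 T)).prod (volume : Measure (UnitAddTorus (Fin 3)))) :=
      (hcomp j).2.1.integrable_mul hb₁.2.2.2
    have hi₂ : Integrable (uncurry fun t (x : UnitAddTorus (Fin 3)) =>
        c j t (Fin.init x) * (a j t (x 1) *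
          Literature.Analysis.FunctionSpaces.Torus.partialDeriv 0 (ψ t) (Fin.init x)))
        (((volume : Measure ℝ).restrict (Ioo 0 T)).prod (volume : Measure (UnitAddTorus (Fin 3)))) :=
      (hcomp j).2.1.integrable_mul (hAb j).1
    have hi₃ : Integrable (uncurry fun t (x : UnitAddTorus (Fin 3)) =>
        c j t (Fin.init x) * Literature.Analysis.FunctionSpaces.Torus.laplacian
          (fun y : UnitAddTorus (Fin 3) => ψ t (Fin.init y)) x)
        (((volume : Measure ℝ).restrict (Ioo 0 T)).prod (volume : Measure (UnitAddTorus (Fin 3)))) :=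
      (hcomp j).2.1.integrable_mul hb₃.2.2.2
    have hi₃' := hi₃.const_mul (ν j)
    have h12 := integral_integral_add hi₁ hi₂
    have h123 := integral_integral_add (hi₁.add hi₂) hi₃'
    simp only [uncurry_apply_pair, Pi.add_apply] at h12 h123
    rw [h12] at h123
    have hI₃' : ∫ t in Ioo 0 T, ∫ x : UnitAddTorus (Fin 3), ν j * (c j t (Fin.init x) *
        Literature.Analysis.FunctionSpaces.Torus.laplacian (fun y : UnitAddTorus (Fin 3) => ψ t (Fin.init y)) x) =
        ν j * I₃ j := by
      simp_rw [integral_const_mul]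
      rfl
    rw [hI₃'] at h123
    rw [← h123]
    exact hw
  -- the limits of the three terms
  have hl₁ : Tendsto I₁ atTop (𝓝 (∫ t in Ioo 0 T, ∫ x : UnitAddTorus (Fin 3),
      W t x * Literature.Analysis.FunctionSpaces.Torus.timeDeriv ψ t (Fin.init x))) :=
    hweak' _ hb₁.2.2.2
  have hl₃ : Tendsto (fun j => ν j * I₃ j) atTop (𝓝 0) := by
    have h := hν₀.mul (hweak' _ hb₃.2.2.2)
    rw [zero_mul] at h
    exact h
  have hl₂ : Tendsto I₂ atTop (𝓝 (∫ t in Ioo 0 T, ∫ x : UnitAddTorus (Fin 3),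
      W t x * (v₁ (x 1) * Literature.Analysis.FunctionSpaces.Torus.partialDeriv 0 (ψ t) (Fin.init x)))) := by
    -- in `L²((vol|_(0,T)) ⊗ vol)`: `c_j ⇀ W` boundedly, `a_j ∂₁ψ → v₁ ∂₁ψ` strongly
    -- uniform bound on `‖c_j‖`
    set B : ℝ≥0∞ := (∫⁻ x, ‖shearData v₁ v₃ x‖ₑ ^ 2) * volume (Ioo (0 : ℝ) T) with hB
    have hBfin : B < ∞ := ENNReal.mul_lt_top hE₀ measure_Ioo_lt_top
    have hc2 : ∀ j, eLpNorm (uncurry fun t (x : UnitAddTorus (Fin 3)) => c j t (Fin.init x)) 2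
        (((volume : Measure ℝ).restrict (Ioo 0 T)).prod (volume : Measure (UnitAddTorus (Fin 3)))) ^ 2 ≤ B := by
      intro j
      rw [Literature.Analysis.FunctionSpaces.eLpNorm_two_pow_two_eq_lintegral,
        lintegral_prod _ ((hcomp j).2.1.1.enorm.pow_const 2)]
      calc ∫⁻ t in Ioo 0 T, ∫⁻ x : UnitAddTorus (Fin 3), ‖c j t (Fin.init x)‖ₑ ^ 2
          ≤ ∫⁻ _ in Ioo (0 : ℝ) T, ∫⁻ x, ‖shearData v₁ v₃ x‖ₑ ^ 2 :=
            setLIntegral_mono measurable_const fun t ht => (hcomp j).2.2.1 t (Ioo_subset_Icc_self ht)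
        _ = B := by rw [lintegral_const, Measure.restrict_apply_univ]
    set M : ℝ := (B ^ (1 / 2 : ℝ)).toReal with hM
    have hvM : ∀ j, ‖(hcomp j).2.1.toLp _‖ ≤ M := by
      intro j
      rw [Lp.norm_toLp, hM]
      refine ENNReal.toReal_mono (ENNReal.rpow_ne_top_of_nonneg (by norm_num) hBfin.ne) ?_
      rw [Literature.Analysis.FunctionSpaces.eLpNorm_two_eq_pow_two_rpow_half]
      exact ENNReal.rpow_le_rpow (hc2 j) (by norm_num)
    -- weak convergence against `v₁ ∂₁ψ`
    have hw : Tendsto (fun j => ⟪(hcomp j).2.1.toLp _, hVb.1.toLp _⟫) atTop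
        (𝓝 ⟪hWL.toLp _, hVb.1.toLp _⟫) := by
      have h := hweak' _ hVb.1
      simp_rw [Literature.Analysis.FunctionSpaces.Torus.inner_toLp_uncurry_eq]
      exact h
    -- strong convergence `a_j ∂₁ψ → v₁ ∂₁ψ`
    have hs : Tendsto (fun j => (hAb j).1.toLp _) atTop (𝓝 (hVb.1.toLp _)) := by
      rw [tendsto_iff_norm_sub_tendsto_zero]
      have hdiff : ∀ j, MemLp (uncurry fun t (x : UnitAddTorus (Fin 3)) => a j t (x 1) - v₁ (x 1)) 2
          (((volume : Measure ℝ).restrict (Ioo 0 T)).prod (volume : Measure (UnitAddTorus (Fin 3)))) :=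
        fun j => (hcomp j).1.sub hV
      have hdb := fun j => memLp_mul_of_bound (hdiff j) hb₂m hK
      have hnorm : ∀ j, ‖(hAb j).1.toLp _ - hVb.1.toLp _‖ ≤
          (ENNReal.ofReal K * eLpNorm (uncurry fun t (x : UnitAddTorus (Fin 3)) => a j t (x 1) - v₁ (x 1)) 2
            (((volume : Measure ℝ).restrict (Ioo 0 T)).prod (volume : Measure (UnitAddTorus (Fin 3))))).toReal := by
        intro j
        rw [← MemLp.toLp_sub, Lp.norm_toLp]
        refine ENNReal.toReal_mono (ENNReal.mul_ne_top ENNReal.ofReal_ne_top (hdiff j).eLpNorm_ne_top) ?_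
        have heq : uncurry (fun t (x : UnitAddTorus (Fin 3)) => a j t (x 1) *
            Literature.Analysis.FunctionSpaces.Torus.partialDeriv 0 (ψ t) (Fin.init x)) -
            uncurry (fun t (x : UnitAddTorus (Fin 3)) => v₁ (x 1) *
            Literature.Analysis.FunctionSpaces.Torus.partialDeriv 0 (ψ t) (Fin.init x)) =
            uncurry fun t (x : UnitAddTorus (Fin 3)) => (a j t (x 1) - v₁ (x 1)) *
              Literature.Analysis.FunctionSpaces.Torus.partialDeriv 0 (ψ t) (Fin.init x) := by
          funext z; simp only [Pi.sub_apply, uncurry]; ring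
        rw [heq]
        exact (hdb j).2
      have hlim : Tendsto (fun j => (ENNReal.ofReal K *
          eLpNorm (uncurry fun t (x : UnitAddTorus (Fin 3)) => a j t (x 1) - v₁ (x 1)) 2
            (((volume : Measure ℝ).restrict (Ioo 0 T)).prod (volume : Measure (UnitAddTorus (Fin 3))))).toReal) atTop (𝓝 0) := by
        have hsq : ∀ j, eLpNorm (uncurry fun t (x : UnitAddTorus (Fin 3)) => a j t (x 1) - v₁ (x 1)) 2
            (((volume : Measure ℝ).restrict (Ioo 0 T)).prod (volume : Measure (UnitAddTorus (Fin 3)))) =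
            (∫⁻ t in Ioo 0 T, ∫⁻ x : UnitAddTorus (Fin 3), ‖a j t (x 1) - v₁ (x 1)‖ₑ ^ 2) ^ (1 / 2 : ℝ) := by
          intro j
          rw [Literature.Analysis.FunctionSpaces.eLpNorm_two_eq_pow_two_rpow_half,
            Literature.Analysis.FunctionSpaces.eLpNorm_two_pow_two_eq_lintegral,
            lintegral_prod _ ((hdiff j).1.enorm.pow_const 2)]
          rfl
        have h1 : Tendsto (fun j => (∫⁻ t in Ioo 0 T, ∫⁻ x : UnitAddTorus (Fin 3), ‖a j t (x 1) - v₁ (x 1)‖ₑ ^ 2) ^ (1 / 2 : ℝ))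
            atTop (𝓝 0) := by
          have h0 : (0 : ℝ≥0∞) ^ (1 / 2 : ℝ) = 0 := ENNReal.zero_rpow_of_pos (by norm_num)
          rw [← h0]
          exact ((ENNReal.continuous_rpow_const (y := (1 / 2 : ℝ))).tendsto 0).comp hheat
        have h2 := ENNReal.Tendsto.const_mul (a := ENNReal.ofReal K) h1 (Or.inr ENNReal.ofReal_ne_top)
        rw [mul_zero] at h2
        have h3 := (ENNReal.tendsto_toReal ENNReal.zero_ne_top).comp h2
        rw [ENNReal.toReal_zero] at h3
        refine h3.congr fun j => ?_
        simp only [comp_apply, hsq]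
      exact squeeze_zero (fun j => norm_nonneg _) hnorm hlim
    have h := Literature.Analysis.FunctionSpaces.tendsto_inner_of_norm_le_of_tendsto hvM hw hs
    simp_rw [Literature.Analysis.FunctionSpaces.Torus.inner_toLp_uncurry_eq] at h
    exact h
  -- conclusion
  have hlim : Tendsto (fun j => I₁ j + I₂ j + ν j * I₃ j + D) atTop
      (𝓝 ((∫ t in Ioo 0 T, ∫ x : UnitAddTorus (Fin 3),
        W t x * Literature.Analysis.FunctionSpaces.Torus.timeDeriv ψ t (Fin.init x)) +
        (∫ t in Ioo 0 T, ∫ x : UnitAddTorus (Fin 3), W t x * (v₁ (x 1) *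
          Literature.Analysis.FunctionSpaces.Torus.partialDeriv 0 (ψ t) (Fin.init x))) + 0 + D)) :=
    ((hl₁.add hl₂).add hl₃).add tendsto_const_nhds
  have hzero : (∫ t in Ioo 0 T, ∫ x : UnitAddTorus (Fin 3),
        W t x * Literature.Analysis.FunctionSpaces.Torus.timeDeriv ψ t (Fin.init x)) +
        (∫ t in Ioo 0 T, ∫ x : UnitAddTorus (Fin 3), W t x * (v₁ (x 1) *
          Literature.Analysis.FunctionSpaces.Torus.partialDeriv 0 (ψ t) (Fin.init x))) + 0 + D = 0 := by
    have hconst : (fun j => I₁ j + I₂ j + ν j * I₃ j + D) = fun _ => 0 := funext hsplit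
    rw [hconst] at hlim
    exact (tendsto_nhds_unique tendsto_const_nhds hlim).symm
  rw [add_zero] at hzero
  have hsum : ∫ t in Ioo 0 T, ∫ x : UnitAddTorus (Fin 3), W t x *
      (Literature.Analysis.FunctionSpaces.Torus.timeDeriv ψ t (Fin.init x) +
        v₁ (x 1) * Literature.Analysis.FunctionSpaces.Torus.partialDeriv 0 (ψ t) (Fin.init x)) =
      (∫ t in Ioo 0 T, ∫ x : UnitAddTorus (Fin 3),
        W t x * Literature.Analysis.FunctionSpaces.Torus.timeDeriv ψ t (Fin.init x)) +
        ∫ t in Ioo 0 T, ∫ x : UnitAddTorus (Fin 3), W t x * (v₁ (x 1) *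
          Literature.Analysis.FunctionSpaces.Torus.partialDeriv 0 (ψ t) (Fin.init x)) := by
    simp_rw [mul_add]
    have h := integral_integral_add (hWL.integrable_mul hb₁.2.2.2) (hWL.integrable_mul hVb.1)
    simp only [uncurry_apply_pair, Pi.mul_apply] at h
    exact h
  rw [hsum]
  exact hzero

end Limit

end Literature.Barriers.AnomalousDissipation

end
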